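import Summits.QuantumFields.YangMills.Theorems.FluctuationComparisonRegPrIntLS2BetaLiftLadderDiscRowTower
import HarnessLib

/-!
# S2β · THE SUP CHAIN — THE DOCK HALF OF `discRow'`: (SPLIT) at `q := 0` in ✓`hSCT_of_discSplit'`'s binder, the `m²`-column's `S′`-share
# with `β_M` PRINTED, and the TOP VANISHING on the fibre (`M 0 B = 0`, relative lift `≡ 1`) that HAZARD «FB-σ» needs

Cell `ym3-torus` (rung R3 = continuum `SU(2)` Yang–Mills on the three-torus at fixed lattice data — NOT d = 4, NOT infinite volume, NOT a mass gap, NOT Clay).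
Width seat «width 20» `ym3-torus-px20` (gen 24), FREE px helper on crux `stmt-QuantumFields-20520`, LINE g18-1 S2β; ARCHITECT px17 g22 2026-08-31 22:21:56Z NAMED
(«(δ) + (ε) as ONE file `…S2BetaDiscRowDockHalf`: (α)'s (SPLIT)+m²-column half by kernel with `β_M` printed, and the t = 0 vanishing that FB-σ now NEEDS»).
`--kind proof --supports stmt-QuantumFields-20520 --as helper`, count-neutral, DEFINITION-FREE (0 `def`, 0 `instance`, 0 `notation`, 0 `sorry`, default heartbeats).

WHAT IS PROVED (sorry-free; `X′ t := Σ_B [(1+κ′)·r(t,B)² + (1+κ′⁻¹)·m(t,B)²]` is ✓p835795 `discRow'`'s EXPLICIT source, `M t B` its parent READ′ Pi-sup, `S′` the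
station's READ′ sum, purse∕`e^{c_XΣθ′}` the station's — all VERBATIM).
* §1 (ε) ★`parentSup_top_eq_zero` — on the fibre (`hmate`) `M 0 B = 0` for every `B` (the level-`J` relative field is `1`); ★`relLift_top_eq` ∕ ★`dist1_relLift_top_eq_zero`
  — at the top height `s = K − (J+1)` the two LIFTED stage fields coincide (✓p835328 `stageTop_eq_of_fibreMate` under `lift s`), so px12 g26's FILE P letter `mA 0 B`
  (`dist1 ((A_U b)⁻¹·A_W b)`) is `0`: RULING «FB-σ» (interim) «the TOP term is REMOVED by (ε)».
* §2 (δ-a) ★★★`hDisc_of_discRow` — the `(hDisc : …)` binder of ✓p835564 `hSCT_of_discSplit'` VERBATIM at `X := fun t => if ht : t < K − J then X′ t ht else 0`, `q := 0`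
  (`dif_pos` ∘ ✓`discRow'`; binders = ✓`discRow'`'s).
* §3 (δ-b) ★★`mColumn_le` — THE `m²`-COLUMN's `S′`-SHARE WITH `β_M` PRINTED: under `0 ≤ a t ≤ ā` (`t < K − J`),
  `Σ_{t<K−J} L^t·(if ht then Σ_B (1+κ′⁻¹)·m(t,B)² else 0) ≤ β_M·S′`, **`β_M := (1+κ′⁻¹)·(π·(6·((5L)²∕4·ā))·(((L−1)∕2+1)·(11∕10·L⁻¹)))²·L`** (pull the constant, ✓`mShare_le`).
* §4 (dock) ★★`hX'_of_rColumn` — from ANY budget of the `r²`-column `Σ_t L^t·(if ht then Σ_B (1+κ′)·r(t,B)² else 0) ≤ C_X·e^{c_XΣθ′}·purse + β_R·S′` ((α)'s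
  half: px21 g25 `…S2BetaSourceBudgetOfColumns` from px16 g24 ✓p835991 W-ρκ γ, px12 g26 FILE P, (k2)): the `(hX' : …)` binder of ✓`hSCT_of_discSplit'` at the same
  `X` with `β_X := β_R + β_M` — so the knit's hDBX edition 3 is `⟨X, hDisc_of_discRow …, hX'_of_rColumn … hR⟩` with `q := 0`.

HONEST SCOPE.  Real bookkeeping over ✓p835795; `ρκ`, `ρ̃`, `a`, `ā`, the arc profile, the `AxStage` clauses, (BKG), the `r²`-column budget `hR`, (ST‴)∕LOC‴, `h3` are
HYPOTHESES or other seats'; nothing of Bałaban's renormalisation-group analysis is asserted or proved ([Balaban1985Averaging] Prop. 4 (128)–(135) pp.37–38,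
[Balaban1985RegularSpaces] (1.19) p.79, (1.29) p.81, [Balaban1987RG1] (0.3)–(0.4) pp.252–253, (0.11) p.253 are the printed objects transcribed); GAP♯∘
(`stub_uniformFibreGapOrbit`, registry 3732b7df UNTOUCHED), the five registered stubs (0∕5), S2β, 20520, 19936, 19200, `YM3TorusSU2` NOT proved; no registered stub is
closed; rung R3 — NOT d = 4, NOT infinite volume, NOT a mass gap, NOT Clay; the Yang–Mills mass gap is NOT proved.
-/

set_option autoImplicit false

namespace Summit.QuantumFields.YangMills.Theorems.FluctuationComparisonRegPrIntLS2BetaDiscRowDockHalf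

open scoped Real
open Literature.MathematicalPhysics.QuantumLattice (su2Quat)
open Literature.MathematicalPhysics.QuantumFieldTheory.Balaban1983to89
open T4Continuum T3ContinuumYM3Torus T3TiltDescent T3LevelShift BlockAveraging AveragingRT B10Eq47AxialChi
open B10Eq27TorusAxialLog (rel axialT transl)
open T4CubeChartGnomonic (SU2)
open T4HaarSU2ExpChart (expPoint)
open T4ExpWindowSmallField (logVec)
open ExpMeanLog (deltaSU)
open T3UnitLawDensityEML (ℰp)
open Summit.QuantumFields.YangMills.Theorems.FluctuationComparisonRegPrIntLS2BetaLiftLadderRowsDock (stageTop_eq_of_fibreMate)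
open Summit.QuantumFields.YangMills.Theorems.FluctuationComparisonRegPrIntLS2BetaLiftLadderDiscRowTower (discRow' mShare_le)

variable {F : T3Family}

/-! ## §1 (ε) The top vanishing on the fibre -/

/-- ★ **`M 0 B = 0` ON THE FIBRE**: the parent READ′ Pi-sup of ✓`discRow'` at `t = 0` reads the level-`J` relative field of the descended pair, which is `1` when the two
fields lie over the same datum (`hmate`). [cite: Balaban1985Averaging, (8) p.19 and (11) p.19; Balaban1987RG1, (0.11) p.253] -/
theorem parentSup_top_eq_zero {J K : ℕ} (hJK : J ≤ K) (U₀ : GaugeField (F.P K) 0 (Matrix.specialUnitaryGroup (Fin 2) ℂ)) (ζ : PBond (F.P K) 0 → EuclideanSpace ℝ (Fin 3))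
    (hmate : descendTo F ℰp J K hJK (fun ℓ => expPoint (ζ ℓ) * U₀ ℓ : GaugeField (F.P K) 0 (Matrix.specialUnitaryGroup (Fin 2) ℂ)) = descendTo F ℰp J K hJK U₀)
    (h0 : 0 < K - J) (B : PBond (F.P J) 0) :
    ‖(fun ℓ' : PBond (F.P (J + 0)) 0 =>
              if ∃ z : Site (F.P (J + 0)) 0,
                (B14.Eq22Determines.blockIter 0 z = (bondShift (F.sitesPerDir_eq (m := F.m) (K := J) (j := 0) (m' := F.m) (K' := J + 0) (j' := 0) (by omega)) B).src ∨ B14.Eq22Determines.blockIter 0 z = (bondShift (F.sitesPerDir_eq (m := F.m) (K := J) (j := 0) (m' := F.m) (K' := J + 0) (j' := 0) (by omega)) B).tgt) ∧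
                ∀ ν, (B10Eq27TorusAxialLog.rel z ℓ'.src ν).natAbs ≤ 2
              then logVec (su2Quat (descendTo F ℰp (J + 0) K (by omega) (fun ℓ => expPoint (ζ ℓ) * U₀ ℓ : GaugeField (F.P K) 0 (Matrix.specialUnitaryGroup (Fin 2) ℂ)) ℓ' * (descendTo F ℰp (J + 0) K (by omega) U₀ ℓ')⁻¹)) else 0)‖ = 0 := by
  have _h := h0
  have hJ0 : J + 0 ≤ K := by omega
  have hm0 : descendTo F ℰp (J + 0) K hJ0 (fun ℓ => expPoint (ζ ℓ) * U₀ ℓ : GaugeField (F.P K) 0 (Matrix.specialUnitaryGroup (Fin 2) ℂ)) =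
      descendTo F ℰp (J + 0) K hJ0 U₀ := hmate
  rw [norm_eq_zero]
  funext ℓ'
  split_ifs with h
  · rw [hm0, mul_inv_cancel, FluctuationComparisonRegPrIntLS2BetaWhitneyHatLift.logVec_su2Quat_one]
    rfl
  · rfl

/-- ★ **THE TWO LIFTED STAGE FIELDS COINCIDE AT THE TOP** (`s + 1 = K − J`): `lift s (g_{s+1}•Ū^{s+1}(e^ζU₀)) = lift s (g₀_{s+1}•Ū^{s+1}U₁)` — ✓`stageTop_eq_of_fibreMate` under
`lift s`; binders = ✓`rows_dock`'s top clauses. [cite: Balaban1985Averaging, (8) p.19 and (11) p.19; Balaban1985Variational, Thm 1 (8)-(10) p.279] -/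
theorem relLift_top_eq {J K : ℕ} (hJK : J ≤ K) (U₀ : GaugeField (F.P K) 0 (Matrix.specialUnitaryGroup (Fin 2) ℂ)) (ζ : PBond (F.P K) 0 → EuclideanSpace ℝ (Fin 3))
    (lift : (j : ℕ) → GaugeField (F.P K) (j + 1) SU2 → GaugeField (F.P K) j SU2)
    (U₁ : GaugeField (F.P K) 0 SU2) (g g₀ : (j : ℕ) → Site (F.P K) j → SU2)
    (hg1 : ∀ j, K - J ≤ j → ∀ y, g j y = 1) (hg1' : ∀ j, K - J ≤ j → ∀ y, g₀ j y = 1)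
    (hT6 : ∀ X : GaugeField (F.P K) 0 SU2, Averaging.iter (fun k => blockAvg (P := F.P K) (j := k) ℰp) (K - J) (GaugeField.gaugeAct (fun x => (g 0 x)⁻¹) X) = Averaging.iter (fun k => blockAvg (P := F.P K) (j := k) ℰp) (K - J) X)
    (hT5r : ∀ X : GaugeField (F.P K) 0 SU2, Averaging.iter (fun k => blockAvg (P := F.P K) (j := k) ℰp) (K - J) (GaugeField.gaugeAct (g₀ 0) X) = Averaging.iter (fun k => blockAvg (P := F.P K) (j := k) ℰp) (K - J) X)
    (hmate : descendTo F ℰp J K hJK (fun ℓ => expPoint (ζ ℓ) * U₀ ℓ : GaugeField (F.P K) 0 (Matrix.specialUnitaryGroup (Fin 2) ℂ)) = descendTo F ℰp J K hJK U₀)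
    (hU₀ : U₀ = GaugeField.gaugeAct (fun x => (g 0 x)⁻¹ * g₀ 0 x) U₁) (h0 : 0 < K - J) :
    lift (K - (J + (0 + 1))) (GaugeField.gaugeAct (g ((K - (J + (0 + 1))) + 1)) (Averaging.iter (fun k => blockAvg (P := F.P K) (j := k) ℰp) ((K - (J + (0 + 1))) + 1) (fun ℓ => expPoint (ζ ℓ) * U₀ ℓ))) =
      lift (K - (J + (0 + 1))) (GaugeField.gaugeAct (g₀ ((K - (J + (0 + 1))) + 1)) (Averaging.iter (fun k => blockAvg (P := F.P K) (j := k) ℰp) ((K - (J + (0 + 1))) + 1) U₁)) :=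
  congrArg (lift (K - (J + (0 + 1)))) (stageTop_eq_of_fibreMate hJK U₀ ζ U₁ g g₀ hg1 hg1' hT6 hT5r hmate hU₀ (K - (J + (0 + 1))) (by omega))

/-- ★ **px12 g26's FILE P letter `mA 0 B` IS `0`**: at the top height every relative LIFT chord `dist1 ((A_U b)⁻¹·A_W b)` vanishes (A_U, A_W spelled as in ✓`discRow'`∕FILE P
at `t = 0`) — RULING «FB-σ» (interim): the top term of the σ-class feedback column is removed. [cite: Balaban1985Averaging, (8) p.19 and (11) p.19; Balaban1987RG1, (0.11) p.253] -/
theorem dist1_relLift_top_eq_zero {J K : ℕ} (hJK : J ≤ K) (U₀ : GaugeField (F.P K) 0 (Matrix.specialUnitaryGroup (Fin 2) ℂ)) (ζ : PBond (F.P K) 0 → EuclideanSpace ℝ (Fin 3))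
    (lift : (j : ℕ) → GaugeField (F.P K) (j + 1) SU2 → GaugeField (F.P K) j SU2)
    (U₁ : GaugeField (F.P K) 0 SU2) (g g₀ : (j : ℕ) → Site (F.P K) j → SU2)
    (hg1 : ∀ j, K - J ≤ j → ∀ y, g j y = 1) (hg1' : ∀ j, K - J ≤ j → ∀ y, g₀ j y = 1)
    (hT6 : ∀ X : GaugeField (F.P K) 0 SU2, Averaging.iter (fun k => blockAvg (P := F.P K) (j := k) ℰp) (K - J) (GaugeField.gaugeAct (fun x => (g 0 x)⁻¹) X) = Averaging.iter (fun k => blockAvg (P := F.P K) (j := k) ℰp) (K - J) X)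
    (hT5r : ∀ X : GaugeField (F.P K) 0 SU2, Averaging.iter (fun k => blockAvg (P := F.P K) (j := k) ℰp) (K - J) (GaugeField.gaugeAct (g₀ 0) X) = Averaging.iter (fun k => blockAvg (P := F.P K) (j := k) ℰp) (K - J) X)
    (hmate : descendTo F ℰp J K hJK (fun ℓ => expPoint (ζ ℓ) * U₀ ℓ : GaugeField (F.P K) 0 (Matrix.specialUnitaryGroup (Fin 2) ℂ)) = descendTo F ℰp J K hJK U₀)
    (hU₀ : U₀ = GaugeField.gaugeAct (fun x => (g 0 x)⁻¹ * g₀ 0 x) U₁) (h0 : 0 < K - J) (b : PBond (F.P K) (K - (J + (0 + 1)))) :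
    dist1 ((lift (K - (J + (0 + 1))) (GaugeField.gaugeAct (g₀ ((K - (J + (0 + 1))) + 1)) (Averaging.iter (fun k => blockAvg (P := F.P K) (j := k) ℰp) ((K - (J + (0 + 1))) + 1) U₁)) b)⁻¹ *
        lift (K - (J + (0 + 1))) (GaugeField.gaugeAct (g ((K - (J + (0 + 1))) + 1)) (Averaging.iter (fun k => blockAvg (P := F.P K) (j := k) ℰp) ((K - (J + (0 + 1))) + 1) (fun ℓ => expPoint (ζ ℓ) * U₀ ℓ))) b) = 0 := by
  rw [relLift_top_eq hJK U₀ ζ lift U₁ g g₀ hg1 hg1' hT6 hT5r hmate hU₀ h0, inv_mul_cancel]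
  exact GaugeGroup.dist1_one

/-! ## §2 (δ-a) (SPLIT) at `q := 0` in ✓`hSCT_of_discSplit'`'s binder -/

/-- ★★★ **THE `hDisc` BINDER OF ✓p835564 `hSCT_of_discSplit'` AT `X := fun t => if ht : t < K − J then X′ t ht else 0`, `q := 0`** (`X′` = ✓p835795 `discRow'`'s explicit
source): `D′lam t ht ≤ X t + 0·E′lam t ht` for every `t < K − J`.  Binders = ✓`discRow'`'s VERBATIM.
[cite: Balaban1985RegularSpaces, (1.19) p.79, (1.29) p.81; Balaban1985Averaging, Prop. 4 (128)-(135) p.37-38; Balaban1987RG1, (0.3)-(0.4) p.252-253, (0.11) p.253] -/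
theorem hDisc_of_discRow
    {J K : ℕ} (hJK : J ≤ K) (U₀ : GaugeField (F.P K) 0 (Matrix.specialUnitaryGroup (Fin 2) ℂ)) (ζ : PBond (F.P K) 0 → EuclideanSpace ℝ (Fin 3))
    (wt : (j : ℕ) → PBond (F.P K) j → PBond (F.P K) (j + 1) → ℝ)
    (lift : (j : ℕ) → GaugeField (F.P K) (j + 1) SU2 → GaugeField (F.P K) j SU2)
    (U₁ : GaugeField (F.P K) 0 SU2) (g g₀ : (j : ℕ) → Site (F.P K) j → SU2)
    (hwt : ∀ j b e, wt j b e = if e.dir = b.dir ∧ (b.src b.dir - emb e.src b.dir).val < (F.P K).L then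
        ∏ ν ∈ Finset.univ.erase b.dir, max 0 (1 - ((rel (emb e.src) b.src ν).natAbs : ℝ) / (F.P K).L) else 0)
    (hlift : ∀ j X b, lift j X b = expPoint (∑ e, wt j b e • ((((F.P K).L : ℕ) : ℝ)⁻¹ • logVec (su2Quat (X e)))))
    (hT3 : ∀ X : GaugeField (F.P K) 0 SU2, ∀ j, j ≤ K - J →
      Averaging.iter (fun k => blockAvg (P := F.P K) (j := k) ℰp) j (GaugeField.gaugeAct (g 0) X) =
        GaugeField.gaugeAct (g j) (Averaging.iter (fun k => blockAvg (P := F.P K) (j := k) ℰp) j X))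
    (hT4 : ∀ j, j < K - J → ∀ x,
      axialT (GaugeField.gaugeAct (g j) (Averaging.iter (fun k => blockAvg (P := F.P K) (j := k) ℰp) j (fun ℓ => expPoint (ζ ℓ) * U₀ ℓ))) (emb (blockOf x)) x =
        axialT (lift j (GaugeField.gaugeAct (g (j + 1)) (Averaging.iter (fun k => blockAvg (P := F.P K) (j := k) ℰp) (j + 1) (fun ℓ => expPoint (ζ ℓ) * U₀ ℓ))))
          (emb (blockOf x)) x)
    (hT3' : ∀ X : GaugeField (F.P K) 0 SU2, ∀ j, j ≤ K - J →
      Averaging.iter (fun k => blockAvg (P := F.P K) (j := k) ℰp) j (GaugeField.gaugeAct (g₀ 0) X) =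
        GaugeField.gaugeAct (g₀ j) (Averaging.iter (fun k => blockAvg (P := F.P K) (j := k) ℰp) j X))
    (hT4' : ∀ j, j < K - J → ∀ x,
      axialT (GaugeField.gaugeAct (g₀ j) (Averaging.iter (fun k => blockAvg (P := F.P K) (j := k) ℰp) j U₁)) (emb (blockOf x)) x =
        axialT (lift j (GaugeField.gaugeAct (g₀ (j + 1)) (Averaging.iter (fun k => blockAvg (P := F.P K) (j := k) ℰp) (j + 1) U₁)))
          (emb (blockOf x)) x)
    (hU₀ : U₀ = GaugeField.gaugeAct (fun x => (g 0 x)⁻¹ * g₀ 0 x) U₁)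
    (hL2 : 2 ≤ F.L) {σ : ℝ} (hσ4 : σ ≤ 1 / 4)
    (hArc : ∀ i, 1 ≤ i → i < K - J → ∀ e : PBond (F.P K) i,
      ‖logVec (su2Quat (GaugeField.gaugeAct (g i) (Averaging.iter (fun k => blockAvg (P := F.P K) (j := k) ℰp) i (fun ℓ => expPoint (ζ ℓ) * U₀ ℓ)) e))‖ ≤ σ ∧
      ‖logVec (su2Quat (GaugeField.gaugeAct (g₀ i) (Averaging.iter (fun k => blockAvg (P := F.P K) (j := k) ℰp) i U₁) e))‖ ≤ σ)
    (hg1 : ∀ j, K - J ≤ j → ∀ y, g j y = 1) (hg1' : ∀ j, K - J ≤ j → ∀ y, g₀ j y = 1)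
    (hT6 : ∀ X : GaugeField (F.P K) 0 SU2, Averaging.iter (fun k => blockAvg (P := F.P K) (j := k) ℰp) (K - J) (GaugeField.gaugeAct (fun x => (g 0 x)⁻¹) X) = Averaging.iter (fun k => blockAvg (P := F.P K) (j := k) ℰp) (K - J) X)
    (hT5r : ∀ X : GaugeField (F.P K) 0 SU2, Averaging.iter (fun k => blockAvg (P := F.P K) (j := k) ℰp) (K - J) (GaugeField.gaugeAct (g₀ 0) X) = Averaging.iter (fun k => blockAvg (P := F.P K) (j := k) ℰp) (K - J) X)
    (hmate : descendTo F ℰp J K hJK (fun ℓ => expPoint (ζ ℓ) * U₀ ℓ : GaugeField (F.P K) 0 (Matrix.specialUnitaryGroup (Fin 2) ℂ)) = descendTo F ℰp J K hJK U₀)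
    (ρκ ρt : ℕ → PBond (F.P J) 0 → ℝ) (a : ℕ → ℝ) (hρκ0 : ∀ t B, 0 ≤ ρκ t B) (hρt0 : ∀ t B, 0 ≤ ρt t B) (ha0 : ∀ t, 0 ≤ a t)
    (hplaq : ∀ t, t < K - J → PlaqSmall (a t) (Averaging.iter (fun k => blockAvg (P := F.P K) (j := k) ℰp) (K - (J + (t + 1))) U₀))
    (hthr : ∀ t, t < K - J → ((((5 * F.L : ℕ) : ℝ)) ^ 2 / 4) * a t < deltaSU (Fin 2))
    (hκrel : ∀ (t : ℕ) (ht : t < K - J) (B : PBond (F.P J) 0) (ℓ' : PBond (F.P (J + (t + 1))) 0), (∃ z : Site (F.P (J + (t + 1))) 0,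
                (B14.Eq22Determines.blockIter (t + 1) z = (bondShift (F.sitesPerDir_eq (m := F.m) (K := J) (j := 0) (m' := F.m) (K' := J + (t + 1)) (j' := t + 1) (by omega)) B).src ∨ B14.Eq22Determines.blockIter (t + 1) z = (bondShift (F.sitesPerDir_eq (m := F.m) (K := J) (j := 0) (m' := F.m) (K' := J + (t + 1)) (j' := t + 1) (by omega)) B).tgt) ∧
                ∀ ν, (B10Eq27TorusAxialLog.rel z ℓ'.src ν).natAbs ≤ 2) →
      blockOf ((bondShift (F.sitesPerDir_eq (m := F.m) (K := J + (t + 1)) (j := 0) (m' := F.m) (K' := K) (j' := (K - (J + (t + 1)))) (by omega)) ℓ').src.shift (bondShift (F.sitesPerDir_eq (m := F.m) (K := J + (t + 1)) (j := 0) (m' := F.m) (K' := K) (j' := (K - (J + (t + 1)))) (by omega)) ℓ').dir) ≠ blockOf (bondShift (F.sitesPerDir_eq (m := F.m) (K := J + (t + 1)) (j := 0) (m' := F.m) (K' := K) (j' := (K - (J + (t + 1)))) (by omega)) ℓ').src →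
      dist1 (corr ℰp (GaugeField.gaugeAct (g (K - (J + (t + 1)))) (Averaging.iter (fun k => blockAvg (P := F.P K) (j := k) ℰp) (K - (J + (t + 1))) (fun ℓ => expPoint (ζ ℓ) * U₀ ℓ))) ⟨blockOf (bondShift (F.sitesPerDir_eq (m := F.m) (K := J + (t + 1)) (j := 0) (m' := F.m) (K' := K) (j' := (K - (J + (t + 1)))) (by omega)) ℓ').src, (bondShift (F.sitesPerDir_eq (m := F.m) (K := J + (t + 1)) (j := 0) (m' := F.m) (K' := K) (j' := (K - (J + (t + 1)))) (by omega)) ℓ').dir⟩ *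
        (corr ℰp (GaugeField.gaugeAct (g₀ (K - (J + (t + 1)))) (Averaging.iter (fun k => blockAvg (P := F.P K) (j := k) ℰp) (K - (J + (t + 1))) U₁)) ⟨blockOf (bondShift (F.sitesPerDir_eq (m := F.m) (K := J + (t + 1)) (j := 0) (m' := F.m) (K' := K) (j' := (K - (J + (t + 1)))) (by omega)) ℓ').src, (bondShift (F.sitesPerDir_eq (m := F.m) (K := J + (t + 1)) (j := 0) (m' := F.m) (K' := K) (j' := (K - (J + (t + 1)))) (by omega)) ℓ').dir⟩)⁻¹) ≤ ρκ t B)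
    (hρ : ∀ (t : ℕ) (ht : t < K - J) (B : PBond (F.P J) 0) (q : Plaq (F.P K) (K - (J + (t + 1)))),
      (∃ ℓ' : PBond (F.P (J + (t + 1))) 0, (∃ z : Site (F.P (J + (t + 1))) 0,
                (B14.Eq22Determines.blockIter (t + 1) z = (bondShift (F.sitesPerDir_eq (m := F.m) (K := J) (j := 0) (m' := F.m) (K' := J + (t + 1)) (j' := t + 1) (by omega)) B).src ∨ B14.Eq22Determines.blockIter (t + 1) z = (bondShift (F.sitesPerDir_eq (m := F.m) (K := J) (j := 0) (m' := F.m) (K' := J + (t + 1)) (j' := t + 1) (by omega)) B).tgt) ∧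
                ∀ ν, (B10Eq27TorusAxialLog.rel z ℓ'.src ν).natAbs ≤ 2) ∧
        (blockOf q.src = blockOf (bondShift (F.sitesPerDir_eq (m := F.m) (K := J + (t + 1)) (j := 0) (m' := F.m) (K' := K) (j' := (K - (J + (t + 1)))) (by omega)) ℓ').src ∨ blockOf q.src = (blockOf (bondShift (F.sitesPerDir_eq (m := F.m) (K := J + (t + 1)) (j := 0) (m' := F.m) (K' := K) (j' := (K - (J + (t + 1)))) (by omega)) ℓ').src).shift (bondShift (F.sitesPerDir_eq (m := F.m) (K := J + (t + 1)) (j := 0) (m' := F.m) (K' := K) (j' := (K - (J + (t + 1)))) (by omega)) ℓ').dir)) →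
      dist1 ((GaugeField.plaqHol (fun b => lift (K - (J + (t + 1))) (GaugeField.gaugeAct (g ((K - (J + (t + 1))) + 1)) (Averaging.iter (fun k => blockAvg (P := F.P K) (j := k) ℰp) ((K - (J + (t + 1))) + 1) (fun ℓ => expPoint (ζ ℓ) * U₀ ℓ))) b *
            (lift (K - (J + (t + 1))) (GaugeField.gaugeAct (g₀ ((K - (J + (t + 1))) + 1)) (Averaging.iter (fun k => blockAvg (P := F.P K) (j := k) ℰp) ((K - (J + (t + 1))) + 1) U₁)) b)⁻¹ *
          (GaugeField.gaugeAct (g₀ (K - (J + (t + 1)))) (Averaging.iter (fun k => blockAvg (P := F.P K) (j := k) ℰp) (K - (J + (t + 1))) U₁)) b : GaugeField (F.P K) (K - (J + (t + 1))) SU2) q)⁻¹ *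
        GaugeField.plaqHol (GaugeField.gaugeAct (g (K - (J + (t + 1)))) (Averaging.iter (fun k => blockAvg (P := F.P K) (j := k) ℰp) (K - (J + (t + 1))) (fun ℓ => expPoint (ζ ℓ) * U₀ ℓ))) q) ≤ ρt t B) {κ' : ℝ} (hκ' : 0 < κ') :
    ∀ (t : ℕ) (ht : t < K - J), (fun (t : ℕ) (ht : t < K - J) => ∑ B : PBond (F.P J) 0,
            ‖(fun ℓ' : PBond (F.P (J + (t + 1))) 0 =>
              if (∃ z : Site (F.P (J + (t + 1))) 0,
                (B14.Eq22Determines.blockIter (t + 1) z = (bondShift (F.sitesPerDir_eq (m := F.m) (K := J) (j := 0) (m' := F.m) (K' := J + (t + 1)) (j' := t + 1) (by omega)) B).src ∨ B14.Eq22Determines.blockIter (t + 1) z = (bondShift (F.sitesPerDir_eq (m := F.m) (K := J) (j := 0) (m' := F.m) (K' := J + (t + 1)) (j' := t + 1) (by omega)) B).tgt) ∧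
                ∀ ν, (B10Eq27TorusAxialLog.rel z ℓ'.src ν).natAbs ≤ 2) ∧
                ¬ (blockOf (ℓ'.src.shift ℓ'.dir) = blockOf ℓ'.src ∧ ∀ ν, ν < ℓ'.dir → B10Eq27TorusAxialLog.rel (emb (blockOf ℓ'.src)) ℓ'.src ν = 0)
              then logVec (su2Quat ((lift (K - (J + (t + 1))) (GaugeField.gaugeAct (g (K - (J + (t + 1)) + 1)) (Averaging.iter (fun k => blockAvg (P := F.P K) (j := k) ℰp) (K - (J + (t + 1)) + 1) (fun ℓ => expPoint (ζ ℓ) * U₀ ℓ))) (bondShift (F.sitesPerDir_eq (m := F.m) (K := J + (t + 1)) (j := 0) (m' := F.m) (K' := K) (j' := (K - (J + (t + 1)))) (by omega)) ℓ') *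
                    (lift (K - (J + (t + 1))) (GaugeField.gaugeAct (g₀ (K - (J + (t + 1)) + 1)) (Averaging.iter (fun k => blockAvg (P := F.P K) (j := k) ℰp) (K - (J + (t + 1)) + 1) U₁)) (bondShift (F.sitesPerDir_eq (m := F.m) (K := J + (t + 1)) (j := 0) (m' := F.m) (K' := K) (j' := (K - (J + (t + 1)))) (by omega)) ℓ'))⁻¹)⁻¹ *
                  (GaugeField.gaugeAct (g (K - (J + (t + 1)))) (Averaging.iter (fun k => blockAvg (P := F.P K) (j := k) ℰp) (K - (J + (t + 1))) (fun ℓ => expPoint (ζ ℓ) * U₀ ℓ)) (bondShift (F.sitesPerDir_eq (m := F.m) (K := J + (t + 1)) (j := 0) (m' := F.m) (K' := K) (j' := (K - (J + (t + 1)))) (by omega)) ℓ') *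
                    (GaugeField.gaugeAct (g₀ (K - (J + (t + 1)))) (Averaging.iter (fun k => blockAvg (P := F.P K) (j := k) ℰp) (K - (J + (t + 1))) U₁) (bondShift (F.sitesPerDir_eq (m := F.m) (K := J + (t + 1)) (j := 0) (m' := F.m) (K' := K) (j' := (K - (J + (t + 1)))) (by omega)) ℓ'))⁻¹))) else 0)‖ ^ 2) t ht ≤ (fun (t : ℕ) => if ht : t < K - J then ∑ B : PBond (F.P J) 0,
            ((1 + κ') * (π / 2 * (ρκ t B + (((2 * ((F.L - 1) / 2) : ℕ) : ℝ)) * ((2 + 2 * (((F.L - 1) / 2 : ℕ) : ℝ)) * ρt t B))) ^ 2 + (1 + κ'⁻¹) * (π * ((6 * (((((5 * F.L : ℕ) : ℝ)) ^ 2 / 4) * a t)) * ((((F.L - 1) / 2 + 1 : ℕ) : ℝ) * (11 / 10 * ((F.L : ℝ)⁻¹ * ‖(fun ℓ' : PBond (F.P (J + t)) 0 =>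
              if ∃ z : Site (F.P (J + t)) 0,
                (B14.Eq22Determines.blockIter t z = (bondShift (F.sitesPerDir_eq (m := F.m) (K := J) (j := 0) (m' := F.m) (K' := J + t) (j' := t) (by omega)) B).src ∨ B14.Eq22Determines.blockIter t z = (bondShift (F.sitesPerDir_eq (m := F.m) (K := J) (j := 0) (m' := F.m) (K' := J + t) (j' := t) (by omega)) B).tgt) ∧
                ∀ ν, (B10Eq27TorusAxialLog.rel z ℓ'.src ν).natAbs ≤ 2
              then logVec (su2Quat (descendTo F ℰp (J + t) K (by omega) (fun ℓ => expPoint (ζ ℓ) * U₀ ℓ : GaugeField (F.P K) 0 (Matrix.specialUnitaryGroup (Fin 2) ℂ)) ℓ' * (descendTo F ℰp (J + t) K (by omega) U₀ ℓ')⁻¹)) else 0)‖))))) ^ 2) else 0) t + 0 * (fun (t : ℕ) (ht : t < K - J) => ∑ B : PBond (F.P J) 0,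
            ‖(fun ℓ' : PBond (F.P (J + (t + 1))) 0 =>
              if ∃ z : Site (F.P (J + (t + 1))) 0,
                (B14.Eq22Determines.blockIter (t + 1) z = (bondShift (F.sitesPerDir_eq (m := F.m) (K := J) (j := 0) (m' := F.m) (K' := J + (t + 1)) (j' := t + 1) (by omega)) B).src ∨ B14.Eq22Determines.blockIter (t + 1) z = (bondShift (F.sitesPerDir_eq (m := F.m) (K := J) (j := 0) (m' := F.m) (K' := J + (t + 1)) (j' := t + 1) (by omega)) B).tgt) ∧
                ∀ ν, (B10Eq27TorusAxialLog.rel z ℓ'.src ν).natAbs ≤ 2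
              then logVec (su2Quat (descendTo F ℰp (J + (t + 1)) K (by omega) (fun ℓ => expPoint (ζ ℓ) * U₀ ℓ : GaugeField (F.P K) 0 (Matrix.specialUnitaryGroup (Fin 2) ℂ)) ℓ' * (descendTo F ℰp (J + (t + 1)) K (by omega) U₀ ℓ')⁻¹)) else 0)‖ ^ 2) t ht := by
  intro t ht
  have h := discRow' hJK U₀ ζ wt lift U₁ g g₀ hwt hlift hT3 hT4 hT3' hT4' hU₀ hL2 hσ4 hArc hg1 hg1' hT6 hT5r hmate ρκ ρt a hρκ0 hρt0 ha0 hplaq hthr hκrel hρ hκ' t ht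
  simp only [dif_pos ht, zero_mul, add_zero]
  exact h

/-! ## §3 (δ-b) The `m²`-column's `S′`-share with `β_M` printed -/

/-- ★★ **THE `m²`-COLUMN OF `Σ_t L^t·X′ t` IS A `β_M·S′` SHARE**, `β_M := (1+κ′⁻¹)·(π·(6·((5L)²∕4·ā))·(((L−1)∕2+1)·(11∕10·L⁻¹)))²·L`, under `0 ≤ a t ≤ ā` (`t < K − J`):
pull the constant out of `Σ_B`, then ✓p835795 `mShare_le` (`Σ_t L^t·Σ_B M(t,B)² ≤ L·S′`). [cite: Balaban1985Averaging, Prop. 4 (128)-(135) p.37-38; Balaban1987RG1, (0.11) p.253] -/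
theorem mColumn_le {J K : ℕ} (hJK : J ≤ K) (U₀ : GaugeField (F.P K) 0 (Matrix.specialUnitaryGroup (Fin 2) ℂ)) (ζ : PBond (F.P K) 0 → EuclideanSpace ℝ (Fin 3))
    (hmate : descendTo F ℰp J K hJK (fun ℓ => expPoint (ζ ℓ) * U₀ ℓ : GaugeField (F.P K) 0 (Matrix.specialUnitaryGroup (Fin 2) ℂ)) = descendTo F ℰp J K hJK U₀)
    (a : ℕ → ℝ) {ā : ℝ} (ha0 : ∀ t, 0 ≤ a t) (ha : ∀ t, t < K - J → a t ≤ ā) {κ' : ℝ} (hκ' : 0 < κ') :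
    ∑ t ∈ Finset.range (K - J), (F.L : ℝ) ^ t * (if ht : t < K - J then
          ∑ B : PBond (F.P J) 0, (1 + κ'⁻¹) * (π * ((6 * (((((5 * F.L : ℕ) : ℝ)) ^ 2 / 4) * a t)) * ((((F.L - 1) / 2 + 1 : ℕ) : ℝ) * (11 / 10 * ((F.L : ℝ)⁻¹ * ‖(fun ℓ' : PBond (F.P (J + t)) 0 =>
              if ∃ z : Site (F.P (J + t)) 0,
                (B14.Eq22Determines.blockIter t z = (bondShift (F.sitesPerDir_eq (m := F.m) (K := J) (j := 0) (m' := F.m) (K' := J + t) (j' := t) (by omega)) B).src ∨ B14.Eq22Determines.blockIter t z = (bondShift (F.sitesPerDir_eq (m := F.m) (K := J) (j := 0) (m' := F.m) (K' := J + t) (j' := t) (by omega)) B).tgt) ∧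
                ∀ ν, (B10Eq27TorusAxialLog.rel z ℓ'.src ν).natAbs ≤ 2
              then logVec (su2Quat (descendTo F ℰp (J + t) K (by omega) (fun ℓ => expPoint (ζ ℓ) * U₀ ℓ : GaugeField (F.P K) 0 (Matrix.specialUnitaryGroup (Fin 2) ℂ)) ℓ' * (descendTo F ℰp (J + t) K (by omega) U₀ ℓ')⁻¹)) else 0)‖))))) ^ 2
        else 0) ≤
      ((1 + κ'⁻¹) * (π * ((6 * (((((5 * F.L : ℕ) : ℝ)) ^ 2 / 4) * ā)) * ((((F.L - 1) / 2 + 1 : ℕ) : ℝ) * (11 / 10 * (F.L : ℝ)⁻¹)))) ^ 2 * (F.L : ℝ)) * (∑ t ∈ Finset.range (K - J), (if ht : t < K - J then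
          (F.L : ℝ) ^ t * ∑ B : PBond (F.P J) 0,
            ‖(fun ℓ' : PBond (F.P (J + (t + 1))) 0 =>
              if ∃ z : Site (F.P (J + (t + 1))) 0,
                (B14.Eq22Determines.blockIter (t + 1) z = (bondShift (F.sitesPerDir_eq (m := F.m) (K := J) (j := 0) (m' := F.m) (K' := J + (t + 1)) (j' := t + 1) (by omega)) B).src ∨ B14.Eq22Determines.blockIter (t + 1) z = (bondShift (F.sitesPerDir_eq (m := F.m) (K := J) (j := 0) (m' := F.m) (K' := J + (t + 1)) (j' := t + 1) (by omega)) B).tgt) ∧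
                ∀ ν, (B10Eq27TorusAxialLog.rel z ℓ'.src ν).natAbs ≤ 2
              then logVec (su2Quat (descendTo F ℰp (J + (t + 1)) K (by omega) (fun ℓ => expPoint (ζ ℓ) * U₀ ℓ : GaugeField (F.P K) 0 (Matrix.specialUnitaryGroup (Fin 2) ℂ)) ℓ' * (descendTo F ℰp (J + (t + 1)) K (by omega) U₀ ℓ')⁻¹)) else 0)‖ ^ 2
        else 0)) := by
  have hc0 : ∀ t, (0 : ℝ) ≤ (π * ((6 * (((((5 * F.L : ℕ) : ℝ)) ^ 2 / 4) * a t)) * ((((F.L - 1) / 2 + 1 : ℕ) : ℝ) * (11 / 10 * (F.L : ℝ)⁻¹)))) := fun t => by have := ha0 t; positivity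
  have hcle : ∀ t, t < K - J → (π * ((6 * (((((5 * F.L : ℕ) : ℝ)) ^ 2 / 4) * a t)) * ((((F.L - 1) / 2 + 1 : ℕ) : ℝ) * (11 / 10 * (F.L : ℝ)⁻¹)))) ≤ (π * ((6 * (((((5 * F.L : ℕ) : ℝ)) ^ 2 / 4) * ā)) * ((((F.L - 1) / 2 + 1 : ℕ) : ℝ) * (11 / 10 * (F.L : ℝ)⁻¹)))) := fun t ht => by
    have := ha t ht
    have hL0 : (0 : ℝ) ≤ (F.L : ℝ)⁻¹ := inv_nonneg.mpr (Nat.cast_nonneg _)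
    gcongr
  have hκ0 : (0 : ℝ) ≤ 1 + κ'⁻¹ := by positivity
  -- termwise: pull the constant and bound `a t ≤ ā`
  have hterm : ∀ t ∈ Finset.range (K - J), (F.L : ℝ) ^ t * (if ht : t < K - J then
          ∑ B : PBond (F.P J) 0, (1 + κ'⁻¹) * (π * ((6 * (((((5 * F.L : ℕ) : ℝ)) ^ 2 / 4) * a t)) * ((((F.L - 1) / 2 + 1 : ℕ) : ℝ) * (11 / 10 * ((F.L : ℝ)⁻¹ * ‖(fun ℓ' : PBond (F.P (J + t)) 0 =>
              if ∃ z : Site (F.P (J + t)) 0,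
                (B14.Eq22Determines.blockIter t z = (bondShift (F.sitesPerDir_eq (m := F.m) (K := J) (j := 0) (m' := F.m) (K' := J + t) (j' := t) (by omega)) B).src ∨ B14.Eq22Determines.blockIter t z = (bondShift (F.sitesPerDir_eq (m := F.m) (K := J) (j := 0) (m' := F.m) (K' := J + t) (j' := t) (by omega)) B).tgt) ∧
                ∀ ν, (B10Eq27TorusAxialLog.rel z ℓ'.src ν).natAbs ≤ 2
              then logVec (su2Quat (descendTo F ℰp (J + t) K (by omega) (fun ℓ => expPoint (ζ ℓ) * U₀ ℓ : GaugeField (F.P K) 0 (Matrix.specialUnitaryGroup (Fin 2) ℂ)) ℓ' * (descendTo F ℰp (J + t) K (by omega) U₀ ℓ')⁻¹)) else 0)‖))))) ^ 2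
        else 0) ≤
      ((1 + κ'⁻¹) * (π * ((6 * (((((5 * F.L : ℕ) : ℝ)) ^ 2 / 4) * ā)) * ((((F.L - 1) / 2 + 1 : ℕ) : ℝ) * (11 / 10 * (F.L : ℝ)⁻¹)))) ^ 2) * ((F.L : ℝ) ^ t * (if ht : t < K - J then
          ∑ B : PBond (F.P J) 0,
            ‖(fun ℓ' : PBond (F.P (J + t)) 0 =>
              if ∃ z : Site (F.P (J + t)) 0,
                (B14.Eq22Determines.blockIter t z = (bondShift (F.sitesPerDir_eq (m := F.m) (K := J) (j := 0) (m' := F.m) (K' := J + t) (j' := t) (by omega)) B).src ∨ B14.Eq22Determines.blockIter t z = (bondShift (F.sitesPerDir_eq (m := F.m) (K := J) (j := 0) (m' := F.m) (K' := J + t) (j' := t) (by omega)) B).tgt) ∧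
                ∀ ν, (B10Eq27TorusAxialLog.rel z ℓ'.src ν).natAbs ≤ 2
              then logVec (su2Quat (descendTo F ℰp (J + t) K (by omega) (fun ℓ => expPoint (ζ ℓ) * U₀ ℓ : GaugeField (F.P K) 0 (Matrix.specialUnitaryGroup (Fin 2) ℂ)) ℓ' * (descendTo F ℰp (J + t) K (by omega) U₀ ℓ')⁻¹)) else 0)‖ ^ 2
        else 0)) := by
    intro t ht'
    have htK : t < K - J := Finset.mem_range.1 ht'
    rw [dif_pos htK, dif_pos htK]
    have hS0 : (0 : ℝ) ≤ ∑ B : PBond (F.P J) 0,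
            ‖(fun ℓ' : PBond (F.P (J + t)) 0 =>
              if ∃ z : Site (F.P (J + t)) 0,
                (B14.Eq22Determines.blockIter t z = (bondShift (F.sitesPerDir_eq (m := F.m) (K := J) (j := 0) (m' := F.m) (K' := J + t) (j' := t) (by omega)) B).src ∨ B14.Eq22Determines.blockIter t z = (bondShift (F.sitesPerDir_eq (m := F.m) (K := J) (j := 0) (m' := F.m) (K' := J + t) (j' := t) (by omega)) B).tgt) ∧
                ∀ ν, (B10Eq27TorusAxialLog.rel z ℓ'.src ν).natAbs ≤ 2
              then logVec (su2Quat (descendTo F ℰp (J + t) K (by omega) (fun ℓ => expPoint (ζ ℓ) * U₀ ℓ : GaugeField (F.P K) 0 (Matrix.specialUnitaryGroup (Fin 2) ℂ)) ℓ' * (descendTo F ℰp (J + t) K (by omega) U₀ ℓ')⁻¹)) else 0)‖ ^ 2 := Finset.sum_nonneg fun B _ => by positivity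
    have hfac : ∑ B : PBond (F.P J) 0, (1 + κ'⁻¹) * (π * ((6 * (((((5 * F.L : ℕ) : ℝ)) ^ 2 / 4) * a t)) * ((((F.L - 1) / 2 + 1 : ℕ) : ℝ) * (11 / 10 * ((F.L : ℝ)⁻¹ * ‖(fun ℓ' : PBond (F.P (J + t)) 0 =>
              if ∃ z : Site (F.P (J + t)) 0,
                (B14.Eq22Determines.blockIter t z = (bondShift (F.sitesPerDir_eq (m := F.m) (K := J) (j := 0) (m' := F.m) (K' := J + t) (j' := t) (by omega)) B).src ∨ B14.Eq22Determines.blockIter t z = (bondShift (F.sitesPerDir_eq (m := F.m) (K := J) (j := 0) (m' := F.m) (K' := J + t) (j' := t) (by omega)) B).tgt) ∧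
                ∀ ν, (B10Eq27TorusAxialLog.rel z ℓ'.src ν).natAbs ≤ 2
              then logVec (su2Quat (descendTo F ℰp (J + t) K (by omega) (fun ℓ => expPoint (ζ ℓ) * U₀ ℓ : GaugeField (F.P K) 0 (Matrix.specialUnitaryGroup (Fin 2) ℂ)) ℓ' * (descendTo F ℰp (J + t) K (by omega) U₀ ℓ')⁻¹)) else 0)‖))))) ^ 2 =
        ((1 + κ'⁻¹) * (π * ((6 * (((((5 * F.L : ℕ) : ℝ)) ^ 2 / 4) * a t)) * ((((F.L - 1) / 2 + 1 : ℕ) : ℝ) * (11 / 10 * (F.L : ℝ)⁻¹)))) ^ 2) * ∑ B : PBond (F.P J) 0,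
            ‖(fun ℓ' : PBond (F.P (J + t)) 0 =>
              if ∃ z : Site (F.P (J + t)) 0,
                (B14.Eq22Determines.blockIter t z = (bondShift (F.sitesPerDir_eq (m := F.m) (K := J) (j := 0) (m' := F.m) (K' := J + t) (j' := t) (by omega)) B).src ∨ B14.Eq22Determines.blockIter t z = (bondShift (F.sitesPerDir_eq (m := F.m) (K := J) (j := 0) (m' := F.m) (K' := J + t) (j' := t) (by omega)) B).tgt) ∧
                ∀ ν, (B10Eq27TorusAxialLog.rel z ℓ'.src ν).natAbs ≤ 2
              then logVec (su2Quat (descendTo F ℰp (J + t) K (by omega) (fun ℓ => expPoint (ζ ℓ) * U₀ ℓ : GaugeField (F.P K) 0 (Matrix.specialUnitaryGroup (Fin 2) ℂ)) ℓ' * (descendTo F ℰp (J + t) K (by omega) U₀ ℓ')⁻¹)) else 0)‖ ^ 2 := by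
      rw [Finset.mul_sum]
      refine Finset.sum_congr rfl fun B _ => ?_
      ring
    rw [hfac]
    have hC : (1 + κ'⁻¹) * (π * ((6 * (((((5 * F.L : ℕ) : ℝ)) ^ 2 / 4) * a t)) * ((((F.L - 1) / 2 + 1 : ℕ) : ℝ) * (11 / 10 * (F.L : ℝ)⁻¹)))) ^ 2 ≤ (1 + κ'⁻¹) * (π * ((6 * (((((5 * F.L : ℕ) : ℝ)) ^ 2 / 4) * ā)) * ((((F.L - 1) / 2 + 1 : ℕ) : ℝ) * (11 / 10 * (F.L : ℝ)⁻¹)))) ^ 2 :=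
      mul_le_mul_of_nonneg_left (pow_le_pow_left₀ (hc0 t) (hcle t htK) 2) hκ0
    calc (F.L : ℝ) ^ t * (((1 + κ'⁻¹) * (π * ((6 * (((((5 * F.L : ℕ) : ℝ)) ^ 2 / 4) * a t)) * ((((F.L - 1) / 2 + 1 : ℕ) : ℝ) * (11 / 10 * (F.L : ℝ)⁻¹)))) ^ 2) * ∑ B : PBond (F.P J) 0,
            ‖(fun ℓ' : PBond (F.P (J + t)) 0 =>
              if ∃ z : Site (F.P (J + t)) 0,
                (B14.Eq22Determines.blockIter t z = (bondShift (F.sitesPerDir_eq (m := F.m) (K := J) (j := 0) (m' := F.m) (K' := J + t) (j' := t) (by omega)) B).src ∨ B14.Eq22Determines.blockIter t z = (bondShift (F.sitesPerDir_eq (m := F.m) (K := J) (j := 0) (m' := F.m) (K' := J + t) (j' := t) (by omega)) B).tgt) ∧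
                ∀ ν, (B10Eq27TorusAxialLog.rel z ℓ'.src ν).natAbs ≤ 2
              then logVec (su2Quat (descendTo F ℰp (J + t) K (by omega) (fun ℓ => expPoint (ζ ℓ) * U₀ ℓ : GaugeField (F.P K) 0 (Matrix.specialUnitaryGroup (Fin 2) ℂ)) ℓ' * (descendTo F ℰp (J + t) K (by omega) U₀ ℓ')⁻¹)) else 0)‖ ^ 2)
        = ((1 + κ'⁻¹) * (π * ((6 * (((((5 * F.L : ℕ) : ℝ)) ^ 2 / 4) * a t)) * ((((F.L - 1) / 2 + 1 : ℕ) : ℝ) * (11 / 10 * (F.L : ℝ)⁻¹)))) ^ 2) * ((F.L : ℝ) ^ t * ∑ B : PBond (F.P J) 0,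
            ‖(fun ℓ' : PBond (F.P (J + t)) 0 =>
              if ∃ z : Site (F.P (J + t)) 0,
                (B14.Eq22Determines.blockIter t z = (bondShift (F.sitesPerDir_eq (m := F.m) (K := J) (j := 0) (m' := F.m) (K' := J + t) (j' := t) (by omega)) B).src ∨ B14.Eq22Determines.blockIter t z = (bondShift (F.sitesPerDir_eq (m := F.m) (K := J) (j := 0) (m' := F.m) (K' := J + t) (j' := t) (by omega)) B).tgt) ∧
                ∀ ν, (B10Eq27TorusAxialLog.rel z ℓ'.src ν).natAbs ≤ 2
              then logVec (su2Quat (descendTo F ℰp (J + t) K (by omega) (fun ℓ => expPoint (ζ ℓ) * U₀ ℓ : GaugeField (F.P K) 0 (Matrix.specialUnitaryGroup (Fin 2) ℂ)) ℓ' * (descendTo F ℰp (J + t) K (by omega) U₀ ℓ')⁻¹)) else 0)‖ ^ 2) := by ring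
      _ ≤ ((1 + κ'⁻¹) * (π * ((6 * (((((5 * F.L : ℕ) : ℝ)) ^ 2 / 4) * ā)) * ((((F.L - 1) / 2 + 1 : ℕ) : ℝ) * (11 / 10 * (F.L : ℝ)⁻¹)))) ^ 2) * ((F.L : ℝ) ^ t * ∑ B : PBond (F.P J) 0,
            ‖(fun ℓ' : PBond (F.P (J + t)) 0 =>
              if ∃ z : Site (F.P (J + t)) 0,
                (B14.Eq22Determines.blockIter t z = (bondShift (F.sitesPerDir_eq (m := F.m) (K := J) (j := 0) (m' := F.m) (K' := J + t) (j' := t) (by omega)) B).src ∨ B14.Eq22Determines.blockIter t z = (bondShift (F.sitesPerDir_eq (m := F.m) (K := J) (j := 0) (m' := F.m) (K' := J + t) (j' := t) (by omega)) B).tgt) ∧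
                ∀ ν, (B10Eq27TorusAxialLog.rel z ℓ'.src ν).natAbs ≤ 2
              then logVec (su2Quat (descendTo F ℰp (J + t) K (by omega) (fun ℓ => expPoint (ζ ℓ) * U₀ ℓ : GaugeField (F.P K) 0 (Matrix.specialUnitaryGroup (Fin 2) ℂ)) ℓ' * (descendTo F ℰp (J + t) K (by omega) U₀ ℓ')⁻¹)) else 0)‖ ^ 2) := mul_le_mul_of_nonneg_right hC (by positivity)
  refine (Finset.sum_le_sum hterm).trans ?_
  rw [← Finset.mul_sum]
  have hsh := mShare_le hJK U₀ ζ hmate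
  have hC0 : (0 : ℝ) ≤ (1 + κ'⁻¹) * (π * ((6 * (((((5 * F.L : ℕ) : ℝ)) ^ 2 / 4) * ā)) * ((((F.L - 1) / 2 + 1 : ℕ) : ℝ) * (11 / 10 * (F.L : ℝ)⁻¹)))) ^ 2 := by positivity
  calc ((1 + κ'⁻¹) * (π * ((6 * (((((5 * F.L : ℕ) : ℝ)) ^ 2 / 4) * ā)) * ((((F.L - 1) / 2 + 1 : ℕ) : ℝ) * (11 / 10 * (F.L : ℝ)⁻¹)))) ^ 2) * ∑ t ∈ Finset.range (K - J), (F.L : ℝ) ^ t * (if ht : t < K - J then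
          ∑ B : PBond (F.P J) 0,
            ‖(fun ℓ' : PBond (F.P (J + t)) 0 =>
              if ∃ z : Site (F.P (J + t)) 0,
                (B14.Eq22Determines.blockIter t z = (bondShift (F.sitesPerDir_eq (m := F.m) (K := J) (j := 0) (m' := F.m) (K' := J + t) (j' := t) (by omega)) B).src ∨ B14.Eq22Determines.blockIter t z = (bondShift (F.sitesPerDir_eq (m := F.m) (K := J) (j := 0) (m' := F.m) (K' := J + t) (j' := t) (by omega)) B).tgt) ∧
                ∀ ν, (B10Eq27TorusAxialLog.rel z ℓ'.src ν).natAbs ≤ 2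
              then logVec (su2Quat (descendTo F ℰp (J + t) K (by omega) (fun ℓ => expPoint (ζ ℓ) * U₀ ℓ : GaugeField (F.P K) 0 (Matrix.specialUnitaryGroup (Fin 2) ℂ)) ℓ' * (descendTo F ℰp (J + t) K (by omega) U₀ ℓ')⁻¹)) else 0)‖ ^ 2
        else 0)
      ≤ ((1 + κ'⁻¹) * (π * ((6 * (((((5 * F.L : ℕ) : ℝ)) ^ 2 / 4) * ā)) * ((((F.L - 1) / 2 + 1 : ℕ) : ℝ) * (11 / 10 * (F.L : ℝ)⁻¹)))) ^ 2) * ((F.L : ℝ) * (∑ t ∈ Finset.range (K - J), (if ht : t < K - J then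
          (F.L : ℝ) ^ t * ∑ B : PBond (F.P J) 0,
            ‖(fun ℓ' : PBond (F.P (J + (t + 1))) 0 =>
              if ∃ z : Site (F.P (J + (t + 1))) 0,
                (B14.Eq22Determines.blockIter (t + 1) z = (bondShift (F.sitesPerDir_eq (m := F.m) (K := J) (j := 0) (m' := F.m) (K' := J + (t + 1)) (j' := t + 1) (by omega)) B).src ∨ B14.Eq22Determines.blockIter (t + 1) z = (bondShift (F.sitesPerDir_eq (m := F.m) (K := J) (j := 0) (m' := F.m) (K' := J + (t + 1)) (j' := t + 1) (by omega)) B).tgt) ∧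
                ∀ ν, (B10Eq27TorusAxialLog.rel z ℓ'.src ν).natAbs ≤ 2
              then logVec (su2Quat (descendTo F ℰp (J + (t + 1)) K (by omega) (fun ℓ => expPoint (ζ ℓ) * U₀ ℓ : GaugeField (F.P K) 0 (Matrix.specialUnitaryGroup (Fin 2) ℂ)) ℓ' * (descendTo F ℰp (J + (t + 1)) K (by omega) U₀ ℓ')⁻¹)) else 0)‖ ^ 2
        else 0))) := mul_le_mul_of_nonneg_left hsh hC0
    _ = ((1 + κ'⁻¹) * (π * ((6 * (((((5 * F.L : ℕ) : ℝ)) ^ 2 / 4) * ā)) * ((((F.L - 1) / 2 + 1 : ℕ) : ℝ) * (11 / 10 * (F.L : ℝ)⁻¹)))) ^ 2 * (F.L : ℝ)) * (∑ t ∈ Finset.range (K - J), (if ht : t < K - J then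
          (F.L : ℝ) ^ t * ∑ B : PBond (F.P J) 0,
            ‖(fun ℓ' : PBond (F.P (J + (t + 1))) 0 =>
              if ∃ z : Site (F.P (J + (t + 1))) 0,
                (B14.Eq22Determines.blockIter (t + 1) z = (bondShift (F.sitesPerDir_eq (m := F.m) (K := J) (j := 0) (m' := F.m) (K' := J + (t + 1)) (j' := t + 1) (by omega)) B).src ∨ B14.Eq22Determines.blockIter (t + 1) z = (bondShift (F.sitesPerDir_eq (m := F.m) (K := J) (j := 0) (m' := F.m) (K' := J + (t + 1)) (j' := t + 1) (by omega)) B).tgt) ∧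
                ∀ ν, (B10Eq27TorusAxialLog.rel z ℓ'.src ν).natAbs ≤ 2
              then logVec (su2Quat (descendTo F ℰp (J + (t + 1)) K (by omega) (fun ℓ => expPoint (ζ ℓ) * U₀ ℓ : GaugeField (F.P K) 0 (Matrix.specialUnitaryGroup (Fin 2) ℂ)) ℓ' * (descendTo F ℰp (J + (t + 1)) K (by omega) U₀ ℓ')⁻¹)) else 0)‖ ^ 2
        else 0)) := by ring

/-! ## §4 The dock: `hX′` of ✓`hSCT_of_discSplit'` from any `r²`-column budget -/

/-- ★★ **THE `hX'` BINDER OF ✓p835564 `hSCT_of_discSplit'` AT `X := fun t => if ht : t < K − J then X′ t ht else 0` FROM ANY `r²`-COLUMN BUDGET**: if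
`Σ_t L^t·(if ht then Σ_B (1+κ′)·r(t,B)² else 0) ≤ C_X·e^{c_XΣθ′}·purse + β_R·S′` ((α)'s half) then `Σ_t L^t·X t ≤ C_X·e^{c_XΣθ′}·purse + (β_R + β_M)·S′` (§3).
[cite: Balaban1985Averaging, Prop. 4 (128)-(135) p.37-38; Balaban1985RegularSpaces, (1.29) p.81; Balaban1987RG1, (0.4), (0.11) p.253] -/
theorem hX'_of_rColumn {J K : ℕ} (hJK : J ≤ K) (U₀ : GaugeField (F.P K) 0 (Matrix.specialUnitaryGroup (Fin 2) ℂ)) (ζ : PBond (F.P K) 0 → EuclideanSpace ℝ (Fin 3))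
    (hmate : descendTo F ℰp J K hJK (fun ℓ => expPoint (ζ ℓ) * U₀ ℓ : GaugeField (F.P K) 0 (Matrix.specialUnitaryGroup (Fin 2) ℂ)) = descendTo F ℰp J K hJK U₀)
    (θ : ℕ → ℝ) (ρκ ρt : ℕ → PBond (F.P J) 0 → ℝ) (a : ℕ → ℝ) {ā : ℝ} (ha0 : ∀ t, 0 ≤ a t) (ha : ∀ t, t < K - J → a t ≤ ā)
    {κ' : ℝ} (hκ' : 0 < κ') {C_X c_X β_R : ℝ}
    (hR : ∑ t ∈ Finset.range (K - J), (F.L : ℝ) ^ t * (if ht : t < K - J then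
          ∑ B : PBond (F.P J) 0, (1 + κ') * (π / 2 * (ρκ t B + (((2 * ((F.L - 1) / 2) : ℕ) : ℝ)) * ((2 + 2 * (((F.L - 1) / 2 : ℕ) : ℝ)) * ρt t B))) ^ 2
        else 0) ≤
      C_X * Real.exp (c_X * ∑ i ∈ Finset.range (K - J), (((5 * F.L : ℕ) : ℝ) ^ 2 / 4) * θ (K - i)) * (((F.L : ℝ)⁻¹) ^ (K - J) * ∑ ℓ : PBond (F.P K) 0, ‖ζ ℓ‖ ^ 2 +
                (F.L : ℝ) ^ (K - J) * ∑ p : Plaq (F.P K) 0,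
                  (1 - reTr ((GaugeField.plaqHol U₀ p)⁻¹ * GaugeField.plaqHol (fun ℓ => expPoint (ζ ℓ) * U₀ ℓ : GaugeField (F.P K) 0 (Matrix.specialUnitaryGroup (Fin 2) ℂ)) p))) +
      β_R * (∑ t ∈ Finset.range (K - J), (if ht : t < K - J then
          (F.L : ℝ) ^ t * ∑ B : PBond (F.P J) 0,
            ‖(fun ℓ' : PBond (F.P (J + (t + 1))) 0 =>
              if ∃ z : Site (F.P (J + (t + 1))) 0,
                (B14.Eq22Determines.blockIter (t + 1) z = (bondShift (F.sitesPerDir_eq (m := F.m) (K := J) (j := 0) (m' := F.m) (K' := J + (t + 1)) (j' := t + 1) (by omega)) B).src ∨ B14.Eq22Determines.blockIter (t + 1) z = (bondShift (F.sitesPerDir_eq (m := F.m) (K := J) (j := 0) (m' := F.m) (K' := J + (t + 1)) (j' := t + 1) (by omega)) B).tgt) ∧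
                ∀ ν, (B10Eq27TorusAxialLog.rel z ℓ'.src ν).natAbs ≤ 2
              then logVec (su2Quat (descendTo F ℰp (J + (t + 1)) K (by omega) (fun ℓ => expPoint (ζ ℓ) * U₀ ℓ : GaugeField (F.P K) 0 (Matrix.specialUnitaryGroup (Fin 2) ℂ)) ℓ' * (descendTo F ℰp (J + (t + 1)) K (by omega) U₀ ℓ')⁻¹)) else 0)‖ ^ 2
        else 0))) :
    ∑ t ∈ Finset.range (K - J), (F.L : ℝ) ^ t * (fun (t : ℕ) => if ht : t < K - J then ∑ B : PBond (F.P J) 0,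
            ((1 + κ') * (π / 2 * (ρκ t B + (((2 * ((F.L - 1) / 2) : ℕ) : ℝ)) * ((2 + 2 * (((F.L - 1) / 2 : ℕ) : ℝ)) * ρt t B))) ^ 2 + (1 + κ'⁻¹) * (π * ((6 * (((((5 * F.L : ℕ) : ℝ)) ^ 2 / 4) * a t)) * ((((F.L - 1) / 2 + 1 : ℕ) : ℝ) * (11 / 10 * ((F.L : ℝ)⁻¹ * ‖(fun ℓ' : PBond (F.P (J + t)) 0 =>
              if ∃ z : Site (F.P (J + t)) 0,
                (B14.Eq22Determines.blockIter t z = (bondShift (F.sitesPerDir_eq (m := F.m) (K := J) (j := 0) (m' := F.m) (K' := J + t) (j' := t) (by omega)) B).src ∨ B14.Eq22Determines.blockIter t z = (bondShift (F.sitesPerDir_eq (m := F.m) (K := J) (j := 0) (m' := F.m) (K' := J + t) (j' := t) (by omega)) B).tgt) ∧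
                ∀ ν, (B10Eq27TorusAxialLog.rel z ℓ'.src ν).natAbs ≤ 2
              then logVec (su2Quat (descendTo F ℰp (J + t) K (by omega) (fun ℓ => expPoint (ζ ℓ) * U₀ ℓ : GaugeField (F.P K) 0 (Matrix.specialUnitaryGroup (Fin 2) ℂ)) ℓ' * (descendTo F ℰp (J + t) K (by omega) U₀ ℓ')⁻¹)) else 0)‖))))) ^ 2) else 0) t ≤
      C_X * Real.exp (c_X * ∑ i ∈ Finset.range (K - J), (((5 * F.L : ℕ) : ℝ) ^ 2 / 4) * θ (K - i)) * (((F.L : ℝ)⁻¹) ^ (K - J) * ∑ ℓ : PBond (F.P K) 0, ‖ζ ℓ‖ ^ 2 +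
                (F.L : ℝ) ^ (K - J) * ∑ p : Plaq (F.P K) 0,
                  (1 - reTr ((GaugeField.plaqHol U₀ p)⁻¹ * GaugeField.plaqHol (fun ℓ => expPoint (ζ ℓ) * U₀ ℓ : GaugeField (F.P K) 0 (Matrix.specialUnitaryGroup (Fin 2) ℂ)) p))) +
      (β_R + ((1 + κ'⁻¹) * (π * ((6 * (((((5 * F.L : ℕ) : ℝ)) ^ 2 / 4) * ā)) * ((((F.L - 1) / 2 + 1 : ℕ) : ℝ) * (11 / 10 * (F.L : ℝ)⁻¹)))) ^ 2 * (F.L : ℝ))) * (∑ t ∈ Finset.range (K - J), (if ht : t < K - J then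
          (F.L : ℝ) ^ t * ∑ B : PBond (F.P J) 0,
            ‖(fun ℓ' : PBond (F.P (J + (t + 1))) 0 =>
              if ∃ z : Site (F.P (J + (t + 1))) 0,
                (B14.Eq22Determines.blockIter (t + 1) z = (bondShift (F.sitesPerDir_eq (m := F.m) (K := J) (j := 0) (m' := F.m) (K' := J + (t + 1)) (j' := t + 1) (by omega)) B).src ∨ B14.Eq22Determines.blockIter (t + 1) z = (bondShift (F.sitesPerDir_eq (m := F.m) (K := J) (j := 0) (m' := F.m) (K' := J + (t + 1)) (j' := t + 1) (by omega)) B).tgt) ∧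
                ∀ ν, (B10Eq27TorusAxialLog.rel z ℓ'.src ν).natAbs ≤ 2
              then logVec (su2Quat (descendTo F ℰp (J + (t + 1)) K (by omega) (fun ℓ => expPoint (ζ ℓ) * U₀ ℓ : GaugeField (F.P K) 0 (Matrix.specialUnitaryGroup (Fin 2) ℂ)) ℓ' * (descendTo F ℰp (J + (t + 1)) K (by omega) U₀ ℓ')⁻¹)) else 0)‖ ^ 2
        else 0)) := by
  have hM := mColumn_le hJK U₀ ζ hmate a ha0 ha hκ'
  -- split `Σ_t L^t·X t` into the two columns, termwise
  have hsplit : ∑ t ∈ Finset.range (K - J), (F.L : ℝ) ^ t * (fun (t : ℕ) => if ht : t < K - J then ∑ B : PBond (F.P J) 0,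
            ((1 + κ') * (π / 2 * (ρκ t B + (((2 * ((F.L - 1) / 2) : ℕ) : ℝ)) * ((2 + 2 * (((F.L - 1) / 2 : ℕ) : ℝ)) * ρt t B))) ^ 2 + (1 + κ'⁻¹) * (π * ((6 * (((((5 * F.L : ℕ) : ℝ)) ^ 2 / 4) * a t)) * ((((F.L - 1) / 2 + 1 : ℕ) : ℝ) * (11 / 10 * ((F.L : ℝ)⁻¹ * ‖(fun ℓ' : PBond (F.P (J + t)) 0 =>
              if ∃ z : Site (F.P (J + t)) 0,
                (B14.Eq22Determines.blockIter t z = (bondShift (F.sitesPerDir_eq (m := F.m) (K := J) (j := 0) (m' := F.m) (K' := J + t) (j' := t) (by omega)) B).src ∨ B14.Eq22Determines.blockIter t z = (bondShift (F.sitesPerDir_eq (m := F.m) (K := J) (j := 0) (m' := F.m) (K' := J + t) (j' := t) (by omega)) B).tgt) ∧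
                ∀ ν, (B10Eq27TorusAxialLog.rel z ℓ'.src ν).natAbs ≤ 2
              then logVec (su2Quat (descendTo F ℰp (J + t) K (by omega) (fun ℓ => expPoint (ζ ℓ) * U₀ ℓ : GaugeField (F.P K) 0 (Matrix.specialUnitaryGroup (Fin 2) ℂ)) ℓ' * (descendTo F ℰp (J + t) K (by omega) U₀ ℓ')⁻¹)) else 0)‖))))) ^ 2) else 0) t =
      ∑ t ∈ Finset.range (K - J), (F.L : ℝ) ^ t * (if ht : t < K - J then
          ∑ B : PBond (F.P J) 0, (1 + κ') * (π / 2 * (ρκ t B + (((2 * ((F.L - 1) / 2) : ℕ) : ℝ)) * ((2 + 2 * (((F.L - 1) / 2 : ℕ) : ℝ)) * ρt t B))) ^ 2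
        else 0) +
      ∑ t ∈ Finset.range (K - J), (F.L : ℝ) ^ t * (if ht : t < K - J then
          ∑ B : PBond (F.P J) 0, (1 + κ'⁻¹) * (π * ((6 * (((((5 * F.L : ℕ) : ℝ)) ^ 2 / 4) * a t)) * ((((F.L - 1) / 2 + 1 : ℕ) : ℝ) * (11 / 10 * ((F.L : ℝ)⁻¹ * ‖(fun ℓ' : PBond (F.P (J + t)) 0 =>
              if ∃ z : Site (F.P (J + t)) 0,
                (B14.Eq22Determines.blockIter t z = (bondShift (F.sitesPerDir_eq (m := F.m) (K := J) (j := 0) (m' := F.m) (K' := J + t) (j' := t) (by omega)) B).src ∨ B14.Eq22Determines.blockIter t z = (bondShift (F.sitesPerDir_eq (m := F.m) (K := J) (j := 0) (m' := F.m) (K' := J + t) (j' := t) (by omega)) B).tgt) ∧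
                ∀ ν, (B10Eq27TorusAxialLog.rel z ℓ'.src ν).natAbs ≤ 2
              then logVec (su2Quat (descendTo F ℰp (J + t) K (by omega) (fun ℓ => expPoint (ζ ℓ) * U₀ ℓ : GaugeField (F.P K) 0 (Matrix.specialUnitaryGroup (Fin 2) ℂ)) ℓ' * (descendTo F ℰp (J + t) K (by omega) U₀ ℓ')⁻¹)) else 0)‖))))) ^ 2
        else 0) := by
    rw [← Finset.sum_add_distrib]
    refine Finset.sum_congr rfl fun t ht' => ?_
    have htK : t < K - J := Finset.mem_range.1 ht'
    simp only [dif_pos htK]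
    rw [← mul_add, ← Finset.sum_add_distrib]
  rw [hsplit, add_mul]
  linarith

end Summit.QuantumFields.YangMills.Theorems.FluctuationComparisonRegPrIntLS2BetaDiscRowDockHalf
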